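import Summits.Ventures.YMGap.RobustBall.EnergyVarianceTorus
import Summits.Ventures.YMGap.RobustBall.TorusRange
import Summits.Ventures.YMGap.RobustBall.TorusOneLink
import Literature.MathematicalPhysics.QuantumFieldTheory.QuasiLocalGaugePerturbationKernels
import HarnessLib

/-!
# Venture YMGap, track ROBUST-BALL (Y2) — THE EXTENSIVE ENERGY-VARIANCE FLOOR IS UNIFORM ON THE TIER-1 TORUS BALL:
# every member `W ∈ ClusterDomainFR ε₀ ε₁ r`, every torus, every coupling

HONEST FRAMING. WHAT THIS IS: a venture file (cell `pub-ymgap`, track Y2 ROBUST-BALL, seat rb-p2, theorems only, 0 compute).  A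
strong-coupling-free LATTICE statement about the finite-volume (torus) Gibbs states `μ_{Λ,β,W} ∝ e^{−β S_W − W} ∏ dU` of the
MEMBERS `W` of rb-theory's tier-1 torus ball `ClusterDomainFR ε₀ ε₁ r` (`RobustBall/Defs.lean`: quasi-local gauge-invariant
perturbations of finite range `r` whose one-link OSCILLATION LOAD is `≤ ε₀`; the Lipschitz load `ε₁` is not used here).  It is the
ball twin of `EnergyVarianceTorus.card_mul_le_variance_wilsonAction` (the Wilson member `W = 0`): for `G = SU(N)` (`N ≥ 2`), torus side
`L ≥ 2`, two directions `i < j`, and every set `S` of sites which are pairwise at periodic sup-distance `> max r 1`,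

  `|S| · e^{−(8(d−1)N|β| + 2ε₀)} · V₀ ≤ Var_{μ_{Λ,β,W}}(S_W)`,   `V₀ = charVariance ρ = ∫ (Re tr ρ)² dHaar`,

for EVERY real `β` and EVERY member `W` — one floor for the whole ball, no smallness of `ε₀`, no Dobrushin door
(`card_mul_le_variance_wilsonAction_of_mem_clusterDomainFR`).  Nothing here is about the continuum limit or a Clay-sense mass gap.

MECHANISM (rb-p2 g8's inverse Efron–Stein route, run for the member): the member's torus state is the Gibbs law of the bounded energy
`A = β S_W + W` on `(SU(N)^{links}, Haar^{⊗})` (`perturbedMeasure_eq_gibbsMeasure`, from lit's `perturbedMeasure_eq_tilted`); the one-link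
oscillation of `A` is `≤ 4(d−1)N|β| + a(e) ≤ 4(d−1)N|β| + ε₀` (ds-2's `total_update_eq` / `localTilt_sub_le_oscLoad`); `A` and `S_W` are
additively separable across two links that lie on no common plaquette and in no common ACTIVE polymer — which is the case for links
based at sites at distance `≥ 2` and `> r` (`total_update_update_sub`, finite range); so `EnergyVarianceGibbsFloor.sum_fibreVariance_le_variance_gibbs`
applies, and the mean Haar fibre variance at `(x, i)` is `≥ e^{−(4(d−1)N|β| + ε₀)} V₀` by resampling the private link `(x, j)` of the base
plaquette (`EnergyVarianceTorus.charVariance_le_integral_fibreVariance`, `exp_neg_mul_integral_resample_le`).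

References: H.-O. Georgii, *Gibbs Measures and Phase Transitions* (2011), Remark 1.24; B. Efron, C. Stein, Ann. Statist. 9 (1981) 586;
T. Bałaban, CMP 119 (1988) p. 259 (format of `W`).  Everything here is proved; no definition, no named fact. [folklore]
-/

noncomputable section

open MeasureTheory ProbabilityTheory Finset Function
open Literature.MathematicalPhysics.QuantumFieldTheory.Balaban1983to89.T4DobrushinTensorisation
open Literature.MathematicalPhysics.QuantumFieldTheory.Balaban1983to89.T4CouplingChain (integrable_of_abs_le_const)
open Literature.MathematicalPhysics.QuantumLattice hiding torusNorm
open Literature.MathematicalPhysics.QuantumFieldTheory hiding ZdEdge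

namespace Summit.Ventures.YMGap.RobustBall

namespace EnergyVariance

variable {d L N : ℕ} [NeZero L] (ρ : SUN N →* Matrix (Fin N) (Fin N) ℂ)

/-! ### The member's torus state is the Gibbs law of the energy `β S_W + W` -/

/-- `μ_{Λ,β,W} = gibbsMeasure (Haar^{⊗ links}) (β S_W + W)` (lit's `perturbedMeasure_eq_tilted` on the `gibbsMeasure` interface of
`T4DobrushinTensorisation`). [folklore] -/
theorem perturbedMeasure_eq_gibbsMeasure (hρ : Continuous ρ) (W : Perturbation d L N) (β : ℝ) :
    W.perturbedMeasure ρ β =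
      gibbsMeasure (fun _ : Edge d L => haarProbability (SUN N))
        (fun U : GaugeConfig d L (SUN N) => β * wilsonAction ρ U + W.total U) := by
  haveI : SecondCountableTopology (Matrix (Fin N) (Fin N) ℂ) :=
    inferInstanceAs (SecondCountableTopology (Fin N → Fin N → ℂ))
  haveI : SecondCountableTopology (SUN N) := Topology.IsEmbedding.subtypeVal.secondCountableTopology
  have h : (fun U : GaugeConfig d L (SUN N) => -β * wilsonAction ρ U - W.total U) =
      fun U => -(β * wilsonAction ρ U + W.total U) := by
    funext U; ring
  rw [QuasiLocalGaugePerturbation.perturbedMeasure_eq_tilted ρ hρ β W, h, gibbsMeasure]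
  unfold Measure.tilted gibbsWeight totalZ
  rfl

/-- The member energy `β S_W + W` is measurable and bounded, and its one-link oscillation at `e` is `≤ 4(d−1)N|β| + a(e)`, `a(e)` the
oscillation load of any load witness (unitary `ρ`). [folklore] -/
theorem memberEnergy_measurable_bounded_osc (hρ : Continuous ρ) (hρu : ∀ g, ρ g ∈ Matrix.unitaryGroup (Fin N) ℂ)
    {W : Perturbation d L N} (w : LoadWitness W) (β : ℝ) :
    Measurable (fun U : GaugeConfig d L (SUN N) => β * wilsonAction ρ U + W.total U) ∧
      (∃ a : ℝ, ∀ U : GaugeConfig d L (SUN N), |β * wilsonAction ρ U + W.total U| ≤ a) ∧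
      ∀ (e : Edge d L) (U : GaugeConfig d L (SUN N)) (y z : SUN N),
        β * wilsonAction ρ (update U e y) + W.total (update U e y) -
            (β * wilsonAction ρ (update U e z) + W.total (update U e z)) ≤
          4 * (d - 1 : ℕ) * N * |β| + w.oscLoad 0 e := by
  haveI : SecondCountableTopology (Matrix (Fin N) (Fin N) ℂ) :=
    inferInstanceAs (SecondCountableTopology (Fin N → Fin N → ℂ))
  haveI : SecondCountableTopology (SUN N) := Topology.IsEmbedding.subtypeVal.secondCountableTopology
  obtain ⟨hAm, ⟨a, hAb⟩, hosc⟩ := energy_measurable_bounded_osc (d := d) (L := L) ρ hρ hρu β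
  obtain ⟨C, hC⟩ := W.exists_abs_total_le
  refine ⟨hAm.add W.measurable_total, ⟨a + C, fun U => (abs_add_le _ _).trans (add_le_add (hAb U) (hC U))⟩,
    fun e U y z => ?_⟩
  have hW : W.total (update U e y) - W.total (update U e z) ≤ w.oscLoad 0 e := by
    rw [total_update_eq W e U y, total_update_eq W e U z, add_sub_add_left_eq_sub]
    exact localTilt_sub_le_oscLoad w e U y z
  linarith [hosc e U y z]

/-! ### Separability of the perturbation across far-apart links -/

/-- Finite range: an activity whose polymer contains two sites at distance `> r` vanishes. [folklore] -/
theorem act_eq_zero_of_lt_torusNorm {W : Perturbation d L N} {r : ℕ} (hW : HasRange r W) {X : Finset (Site d L)}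
    {x y : Site d L} (hx : x ∈ X) (hy : y ∈ X) (hfar : r < torusNorm (x - y)) : W.act X = 0 :=
  hW X (lt_of_lt_of_le hfar (torusNorm_sub_le_polymerDiam hx hy))

/-- **The total perturbation is additively separable across two links lying in no common active polymer**:
`W(U^{e'←y, e←z}) − W(U^{e←z}) = W(U^{e'←y}) − W(U)`. [folklore] -/
theorem total_update_update_sub {W : Perturbation d L N} {e e' : Edge d L} (hne : e ≠ e')
    (h : ∀ X ∈ polymers (d := d) (L := L) 1, e.1 ∈ X → e'.1 ∈ X → W.act X = 0)
    (U : GaugeConfig d L (SUN N)) (y z : SUN N) :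
    W.total (update (update U e' y) e z) - W.total (update U e z) = W.total (update U e' y) - W.total U := by
  classical
  unfold QuasiLocalGaugePerturbation.total
  rw [← Finset.sum_sub_distrib, ← Finset.sum_sub_distrib]
  refine Finset.sum_congr rfl fun X hX => ?_
  by_cases he : e.1 ∈ X
  · by_cases he' : e'.1 ∈ X
    · simp [h X hX he he']
    · rw [update_comm (Ne.symm hne), act_update_of_not_mem W he' (update U e z) y, act_update_of_not_mem W he' U y,
        sub_self, sub_self]
  · rw [act_update_of_not_mem W he (update U e' y) z, act_update_of_not_mem W he U z]

/-- Under finite range `r`, links based at sites at distance `> r` lie in no common active polymer. [folklore] -/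
theorem act_eq_zero_of_mem_of_mem {W : Perturbation d L N} {r : ℕ} (hW : HasRange r W) {e e' : Edge d L}
    (hfar : r < torusNorm (e.1 - e'.1)) :
    ∀ X ∈ polymers (d := d) (L := L) 1, e.1 ∈ X → e'.1 ∈ X → W.act X = 0 :=
  fun _ _ he he' => act_eq_zero_of_lt_torusNorm hW he he' hfar

omit [NeZero L] in
/-- Links based at sites at periodic sup-distance `≥ 2` lie on no common plaquette. [folklore] -/
theorem not_mem_plaqEdgesT_of_two_le_torusNorm {e e' : Edge d L} (h : 2 ≤ torusNorm (e.1 - e'.1))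
    (q : Plaquette d L) (he : e ∈ plaqEdgesT q) : e' ∉ plaqEdgesT q := fun he' => by
  have := torusNorm_sub_le_one_of_mem_plaqEdgesT he he'
  omega

/-! ### The extensive energy-variance floor, uniformly on the ball -/

/-- ★★ **EXTENSIVE FLOOR FOR THE ENERGY VARIANCE OF A PERTURBED TORUS STATE, at every coupling.**  `G = SU(N)` (`N ≥ 2`), torus of
side `L ≥ 2`, `i < j` two directions, `W` a quasi-local gauge-invariant perturbation of finite range `r` with a load witness whose
oscillation load is `≤ ε₀` at every link, `S` a set of sites pairwise at periodic sup-distance `≥ 2` and `> r`.  Then for every real `β`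

  `|S| · e^{−(8(d−1)N|β| + 2ε₀)} · V₀ ≤ ∫ (S_W − ∫ S_W dμ_{Λ,β,W})² dμ_{Λ,β,W}`,   `V₀ = charVariance ρ`.

(Inverse Efron–Stein over the direction-`i` links based in `S`, one-link density floor `e^{−(4(d−1)N|β| + ε₀)}` twice, private-link
resampling.) [folklore] -/
theorem card_mul_le_variance_wilsonAction_member (hρ : IsSpecialUnitaryModel ρ) (hN : 2 ≤ N) (hL : 1 < L) {i j : Fin d}
    (hij : i < j) {W : Perturbation d L N} {r : ℕ} (hWr : HasRange r W) (w : LoadWitness W) {ε₀ : ℝ}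
    (hw : ∀ e, w.oscLoad 0 e ≤ ε₀) (S : Finset (Site d L))
    (hS2 : ∀ x ∈ S, ∀ x' ∈ S, x ≠ x' → 2 ≤ torusNorm (x - x'))
    (hSr : ∀ x ∈ S, ∀ x' ∈ S, x ≠ x' → r < torusNorm (x - x')) (β : ℝ) :
    (S.card : ℝ) * Real.exp (-(8 * (d - 1 : ℕ) * N * |β| + 2 * ε₀)) * PlaquetteLowerBound.charVariance ρ ≤
      ∫ U, (wilsonAction ρ U - ∫ V, wilsonAction ρ V ∂W.perturbedMeasure ρ β) ^ 2 ∂W.perturbedMeasure ρ β := by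
  classical
  haveI : SecondCountableTopology (Matrix (Fin N) (Fin N) ℂ) :=
    inferInstanceAs (SecondCountableTopology (Fin N → Fin N → ℂ))
  haveI : SecondCountableTopology (SUN N) := Topology.IsEmbedding.subtypeVal.secondCountableTopology
  have hρc : Continuous ρ := hρ.1
  have hρu := IsSpecialUnitaryModel.mem_unitaryGroup ρ hρ
  set π : Edge d L → Measure (SUN N) := fun _ => haarProbability (SUN N) with hπ
  set A : GaugeConfig d L (SUN N) → ℝ := fun U => β * wilsonAction ρ U + W.total U with hA
  obtain ⟨hAm, ⟨a, hAb⟩, hosc⟩ := memberEnergy_measurable_bounded_osc (d := d) (L := L) ρ hρc hρu w β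
  set D : ℝ := 4 * (d - 1 : ℕ) * N * |β| + ε₀ with hD
  have hoscD : ∀ (e : Edge d L) (U : GaugeConfig d L (SUN N)) (y z : SUN N),
      A (update U e y) - A (update U e z) ≤ D := fun e U y z =>
    (hosc e U y z).trans (by rw [hD]; linarith [hw e])
  haveI : ∀ e, IsMarkovKernel (gibbsKernel π A e) := fun e => isMarkovKernel_gibbsKernel hAm hAb e
  haveI hQ : IsProbabilityMeasure (gibbsMeasure π A) := isProbabilityMeasure_gibbsMeasure (π := π) hAm hAb
  have hinv : ResamplingInvariant (gibbsMeasure π A) (gibbsKernel π A) := resamplingInvariant_gibbs (π := π) hAm hAb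
  rw [perturbedMeasure_eq_gibbsMeasure ρ hρc W β]
  change (S.card : ℝ) * Real.exp (-(8 * (d - 1 : ℕ) * N * |β| + 2 * ε₀)) * PlaquetteLowerBound.charVariance ρ ≤
    ∫ U, (wilsonAction ρ U - ∫ V, wilsonAction ρ V ∂gibbsMeasure π A) ^ 2 ∂gibbsMeasure π A
  obtain ⟨B, hB⟩ := exists_abs_wilsonAction_le (d := d) (L := L) ρ hρc
  -- the link set
  set F : Finset (Edge d L) := S.image fun x => (x, i) with hF
  have hFcard : F.card = S.card := Finset.card_image_of_injective _ fun x x' h => (Prod.mk.inj h).1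
  have hFmem : ∀ e ∈ F, ∀ e' ∈ F, e ≠ e' → 2 ≤ torusNorm (e.1 - e'.1) ∧ r < torusNorm (e.1 - e'.1) := by
    intro e he e' he' hee'
    obtain ⟨x, hx, rfl⟩ := Finset.mem_image.1 he
    obtain ⟨x', hx', rfl⟩ := Finset.mem_image.1 he'
    have hxx' : x ≠ x' := fun h => hee' (by rw [h])
    exact ⟨hS2 x hx x' hx' hxx', hSr x hx x' hx' hxx'⟩
  have hsep : ∀ e ∈ F, ∀ e' ∈ F, e ≠ e' → ∀ q : Plaquette d L, e ∈ plaqEdgesT q → e' ∉ plaqEdgesT q :=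
    fun e he e' he' hee' q hq => not_mem_plaqEdgesT_of_two_le_torusNorm (hFmem e he e' he' hee').1 q hq
  have hsepW : ∀ e ∈ F, ∀ e' ∈ F, e ≠ e' → ∀ (U : GaugeConfig d L (SUN N)) (y z : SUN N),
      W.total (update (update U e' y) e z) - W.total (update U e z) = W.total (update U e' y) - W.total U :=
    fun e he e' he' hee' U y z =>
      total_update_update_sub hee' (act_eq_zero_of_mem_of_mem hWr (hFmem e he e' he' hee').2) U y z
  -- Step 1: inverse Efron–Stein for the Gibbs law
  have h1 := sum_fibreVariance_le_variance_gibbs (π := π) hAm hAb (measurable_wilsonAction ρ hρc) hB F (δ := D)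
    (fun e _ U y z => hoscD e U y z)
    (fun e he e' he' hne U y z => by
      show β * _ + _ - (β * _ + _) = β * _ + _ - (β * _ + _)
      have hSW := wilsonAction_update_update_sub ρ (hsep e he e' he' hne) U y z
      have hWW := hsepW e he e' he' hne U y z
      linear_combination β * hSW + hWW)
    (fun e he e' he' hne U y z => wilsonAction_update_update_sub ρ (hsep e he e' he' hne) U y z)
  -- Step 2: each mean fibre variance is at least `e^{−D} V₀` (resample the private link `(x, j)`)
  have h2 : ∀ e ∈ F, Real.exp (-D) * PlaquetteLowerBound.charVariance ρ ≤
      ∫ U, (∫ h, (wilsonAction ρ (update U e h) - ∫ z, wilsonAction ρ (update U e z) ∂π e) ^ 2 ∂π e) ∂gibbsMeasure π A := by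
    intro e he
    obtain ⟨x, hx, rfl⟩ := Finset.mem_image.1 he
    obtain ⟨hgm, hg0, C, hgC⟩ := measurable_fibreVariance_wilsonAction (d := d) (L := L) ρ hρc (x, i)
    have hres := exp_neg_mul_integral_resample_le (π := π) hAm hAb hinv (x, j) (δ := D) (fun U y z => hoscD (x, j) U y z)
      hgm hgC hg0
    refine le_trans ?_ hres
    refine mul_le_mul_of_nonneg_left ?_ (Real.exp_pos _).le
    have hpt : ∀ U : GaugeConfig d L (SUN N), PlaquetteLowerBound.charVariance ρ ≤
        ∫ y, (∫ h, (wilsonAction ρ (update (update U (x, j) y) (x, i) h) -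
          ∫ z, wilsonAction ρ (update (update U (x, j) y) (x, i) z) ∂π (x, i)) ^ 2 ∂π (x, i)) ∂π (x, j) :=
      fun U => charVariance_le_integral_fibreVariance ρ hρ hN hL hij U
    calc PlaquetteLowerBound.charVariance ρ = ∫ _U, PlaquetteLowerBound.charVariance ρ ∂gibbsMeasure π A := by
          rw [integral_const, smul_eq_mul, probReal_univ, one_mul]
      _ ≤ _ := by
          refine integral_mono_of_nonneg (Filter.Eventually.of_forall fun U => ?_) ?_
            (Filter.Eventually.of_forall hpt)
          · exact (PlaquetteLowerBound.charVariance_pos ρ hρc (by omega)).le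
          · have hm : Measurable fun U : GaugeConfig d L (SUN N) => ∫ y, (∫ h,
                (wilsonAction ρ (update (update U (x, j) y) (x, i) h) -
                  ∫ z, wilsonAction ρ (update (update U (x, j) y) (x, i) z) ∂π (x, i)) ^ 2 ∂π (x, i)) ∂π (x, j) :=
              ((hgm.comp measurable_update').stronglyMeasurable.integral_prod_right' (ν := π (x, j))).measurable
            exact integrable_of_abs_le_const hm.stronglyMeasurable fun U => abs_integral_le_of_abs_le _ fun y => hgC _
  -- Step 3: assemble
  have h3 : ∑ e ∈ F, Real.exp (-D) * PlaquetteLowerBound.charVariance ρ ≤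
      ∑ e ∈ F, ∫ U, (∫ h, (wilsonAction ρ (update U e h) - ∫ z, wilsonAction ρ (update U e z) ∂π e) ^ 2 ∂π e)
        ∂gibbsMeasure π A := Finset.sum_le_sum h2
  rw [Finset.sum_const, nsmul_eq_mul, hFcard] at h3
  have hexp : Real.exp (-(8 * (d - 1 : ℕ) * N * |β| + 2 * ε₀)) = Real.exp (-D) * Real.exp (-D) := by
    rw [← Real.exp_add, hD]; ring_nf
  calc (S.card : ℝ) * Real.exp (-(8 * (d - 1 : ℕ) * N * |β| + 2 * ε₀)) * PlaquetteLowerBound.charVariance ρ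
      = Real.exp (-D) * ((S.card : ℝ) * (Real.exp (-D) * PlaquetteLowerBound.charVariance ρ)) := by rw [hexp]; ring
    _ ≤ Real.exp (-D) * ∑ e ∈ F, ∫ U, (∫ h, (wilsonAction ρ (update U e h) -
          ∫ z, wilsonAction ρ (update U e z) ∂π e) ^ 2 ∂π e) ∂gibbsMeasure π A :=
        mul_le_mul_of_nonneg_left h3 (Real.exp_pos _).le
    _ ≤ _ := h1

/-- ★★ **THE FLOOR IS UNIFORM ON THE TIER-1 TORUS BALL.**  For every member `W ∈ ClusterDomainFR ε₀ ε₁ r` (finite range `r`,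
oscillation load `≤ ε₀`; `ε₁` unused), every torus side `L ≥ 2`, every real `β`, and every set `S` of sites pairwise at periodic
sup-distance `> max r 1`:
`|S| · e^{−(8(d−1)N|β| + 2ε₀)} · V₀ ≤ ∫ (S_W − ⟨S_W⟩)² dμ_{Λ,β,W}` — one constant for the whole ball. [folklore] -/
theorem card_mul_le_variance_wilsonAction_of_mem_clusterDomainFR (hρ : IsSpecialUnitaryModel ρ) (hN : 2 ≤ N) (hL : 1 < L)
    {i j : Fin d} (hij : i < j) {ε₀ ε₁ : ℝ} {r : ℕ} {W : Perturbation d L N} (hW : W ∈ ClusterDomainFR ε₀ ε₁ r)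
    (S : Finset (Site d L)) (hS : ∀ x ∈ S, ∀ x' ∈ S, x ≠ x' → max r 1 < torusNorm (x - x')) (β : ℝ) :
    (S.card : ℝ) * Real.exp (-(8 * (d - 1 : ℕ) * N * |β| + 2 * ε₀)) * PlaquetteLowerBound.charVariance ρ ≤
      ∫ U, (wilsonAction ρ U - ∫ V, wilsonAction ρ V ∂W.perturbedMeasure ρ β) ^ 2 ∂W.perturbedMeasure ρ β := by
  obtain ⟨hWr, w, hw, -⟩ := hW
  refine card_mul_le_variance_wilsonAction_member ρ hρ hN hL hij hWr w hw S (fun x hx x' hx' hne => ?_)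
    (fun x hx x' hx' hne => lt_of_le_of_lt (le_max_left r 1) (hS x hx x' hx' hne)) β
  have := hS x hx x' hx' hne
  have h1 : 1 ≤ max r 1 := le_max_right r 1
  omega

/-- The same uniform floor for the Mathlib variance `Var[S_W; μ_{Λ,β,W}]`. [folklore] -/
theorem card_mul_le_variance_wilsonAction_of_mem_clusterDomainFR' (hρ : IsSpecialUnitaryModel ρ) (hN : 2 ≤ N) (hL : 1 < L)
    {i j : Fin d} (hij : i < j) {ε₀ ε₁ : ℝ} {r : ℕ} {W : Perturbation d L N} (hW : W ∈ ClusterDomainFR ε₀ ε₁ r)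
    (S : Finset (Site d L)) (hS : ∀ x ∈ S, ∀ x' ∈ S, x ≠ x' → max r 1 < torusNorm (x - x')) (β : ℝ) :
    (S.card : ℝ) * Real.exp (-(8 * (d - 1 : ℕ) * N * |β| + 2 * ε₀)) * PlaquetteLowerBound.charVariance ρ ≤
      Var[wilsonAction (d := d) (L := L) (G := SUN N) ρ; W.perturbedMeasure ρ β] := by
  haveI : SecondCountableTopology (Matrix (Fin N) (Fin N) ℂ) :=
    inferInstanceAs (SecondCountableTopology (Fin N → Fin N → ℂ))
  haveI : SecondCountableTopology (SUN N) := Topology.IsEmbedding.subtypeVal.secondCountableTopology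
  rw [variance_eq_integral (measurable_wilsonAction ρ hρ.1).aemeasurable]
  exact card_mul_le_variance_wilsonAction_of_mem_clusterDomainFR ρ hρ hN hL hij hW S hS β

end EnergyVariance

end Summit.Ventures.YMGap.RobustBall
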